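/-
Copyright: cell `pub-balaban-gaps` (G2), seat ne6 (row NE7b), `prover-pub-balaban-gaps-ne6-g16-0`. Project licence.
-/
import Summits.QuantumFields.BalabanUV.T4Continuum.Spine.NE7b.CompactFibreWindowSU2DoublingHaar
import Summits.QuantumFields.BalabanUV.T4Continuum.Spine.NE7b.CompactFibreSU2ClassIntegral
import Mathlib.MeasureTheory.Integral.Gamma
import Mathlib.Analysis.SpecialFunctions.Gaussian.GaussianIntegral
import Mathlib.Analysis.SpecialFunctions.Trigonometric.Bounds

/-!
# Census V41: THE ONE-PLAQUETTE MASS OF THE `SU(2)` FIBRE BY VALUE —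
# `e⁻¹∕8 · β^{−3∕2} ≤ ∫ e^{−β·Re tr(1 − V)} dHaar_{SU(2)}(V) ≤ (π²√π∕16) · β^{−3∕2}` (row NE7b, node U5c; MODEL, [folklore])

Cell `pub-balaban-gaps` (G2 spine census) for the `pub-balaban` T⁴ crux NE7b (NOT PRINTED, NOT PROVED).  V39 (`CompactFibrePlaquetteMassSUN`) proved the
one-plaquette mass of `SU(N)` is at the Gaussian rate `β^{−(N²−1)∕2}` with SOFT constants (`∃ c, C′`).  For `N = 2` this file prints the constants:
the window floor `(√t)³∕8 ≤ Haar{Re tr(1 − V) ≤ t}` (`0 < t ≤ 4`, from junction J1's `D = 1` doubling), Chebyshev from below, and Weyl's formula (V40e) with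
Jordan's inequality `1 − cos ψ ≥ 2ψ²∕π²` and `sin ψ ≤ ψ` from above, closed by Mathlib's `∫₀^∞ x^q e^{−bx^p}` (`integral_rpow_mul_exp_neg_mul_rpow`) and `Γ(1∕2) = √π`.
The true asymptotics is `Z(β) ~ (2√π)⁻¹ β^{−3∕2}`; the printed bracket `[e⁻¹∕8, π²√π∕16] = [0.0459…, 1.0933…]` is honest, not sharp.
No `def`, zero `sorry`, nothing of Bałaban's asserted.  BY-NAME EFFECT ON THE WALL: NONE.
HONEST DEPENDENCY: continuum YM on T⁴ ⇐ BetaPertH ∧ nine spine estimates (0/9 proved); BetaPertH ⇐ (D1) ∧ (D4) ∧ CAP+tail;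
G-an2-4 gates asym, D1 and NE2/3/4.  This file changes none of it.
-/

set_option autoImplicit false

noncomputable section

open MeasureTheory Real Set
open Literature.MathematicalPhysics.QuantumFieldTheory (haarProbability)
open Summit.QuantumFields.BalabanUV.T4Continuum.NE7b.CompactFibreWindowSU2DoublingHaar (re_trace_one_sub_eq abs_re_trace_le_two haarReal_traceWindow_doubling_one)
open Summit.QuantumFields.BalabanUV.T4Continuum.NE7b.CompactFibreSU2ClassIntegral (integral_exp_neg_traceDeficit_eq)

namespace Summit.QuantumFields.BalabanUV.T4Continuum.NE7b.CompactFibrePlaquetteMassSU2Explicit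

/-- On `SU(2)`, `0 ≤ Re tr(1 − V) ≤ 4`. [folklore] -/
theorem re_trace_one_sub_mem (V : Matrix.specialUnitaryGroup (Fin 2) ℂ) :
    0 ≤ (Matrix.trace (1 - (V : Matrix (Fin 2) (Fin 2) ℂ))).re ∧ (Matrix.trace (1 - (V : Matrix (Fin 2) (Fin 2) ℂ))).re ≤ 4 := by
  have h := abs_le.1 (abs_re_trace_le_two V)
  rw [re_trace_one_sub_eq]; constructor <;> linarith [h.1, h.2]

/-- **THE WINDOW FLOOR BY VALUE**: `(√t)³∕8 ≤ Haar_{SU(2)}{Re tr(1 − V) ≤ t}` for `0 < t ≤ 4` — junction J1's `D = 1` doubling read downward from the full window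
`{Re tr(1 − V) ≤ 4} = SU(2)` with `λ = 2∕√t` (equality at `t = 4`; the exact law is V40a's `(ψ − sin ψ cos ψ)∕π`, `t = 2 − 2cos ψ`). [folklore] -/
theorem sqrt_cube_div_eight_le_haarReal_traceWindow {t : ℝ} (ht0 : 0 < t) (ht4 : t ≤ 4) :
    Real.sqrt t ^ 3 / 8 ≤ (haarProbability (Matrix.specialUnitaryGroup (Fin 2) ℂ)).real
      {V : Matrix.specialUnitaryGroup (Fin 2) ℂ | (Matrix.trace (1 - (V : Matrix (Fin 2) (Fin 2) ℂ))).re ≤ t} := by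
  have hst : 0 < Real.sqrt t := Real.sqrt_pos.2 ht0
  have hs2 : Real.sqrt t ≤ 2 := by
    rw [show (2 : ℝ) = Real.sqrt (2 ^ 2) by rw [Real.sqrt_sq (by norm_num : (0:ℝ) ≤ 2)]]
    exact Real.sqrt_le_sqrt (by norm_num; exact ht4)
  have hl : 1 ≤ 2 / Real.sqrt t := by rw [le_div_iff₀ hst]; linarith
  have h := haarReal_traceWindow_doubling_one hl t
  have hsq : (2 / Real.sqrt t) ^ 2 * t = 4 := by
    rw [div_pow, Real.sq_sqrt ht0.le, div_mul_cancel₀ _ ht0.ne']; norm_num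
  have huniv : {V : Matrix.specialUnitaryGroup (Fin 2) ℂ | (Matrix.trace (1 - (V : Matrix (Fin 2) (Fin 2) ℂ))).re ≤ (2 / Real.sqrt t) ^ 2 * t} = Set.univ :=
    Set.eq_univ_of_forall fun V => by rw [Set.mem_setOf_eq, hsq]; exact (re_trace_one_sub_mem V).2
  rw [huniv, probReal_univ, div_pow, show (2 : ℝ) ^ 3 = 8 by norm_num, div_mul_eq_mul_div, le_div_iff₀ (by positivity)] at h
  rw [div_le_iff₀ (by norm_num : (0:ℝ) < 8)]
  linarith

/-- **CHEBYSHEV FROM BELOW**: `e^{−βt}·Haar_{SU(2)}{Re tr(1 − V) ≤ t} ≤ ∫ e^{−β·Re tr(1 − V)} dHaar_{SU(2)}` for `β ≥ 0` and every real `t`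
(Markov's inequality for the Boltzmann factor). [folklore] -/
theorem exp_neg_mul_haarReal_le_plaquetteMass {β : ℝ} (hβ : 0 ≤ β) (t : ℝ) :
    Real.exp (-(β * t)) * (haarProbability (Matrix.specialUnitaryGroup (Fin 2) ℂ)).real
        {V : Matrix.specialUnitaryGroup (Fin 2) ℂ | (Matrix.trace (1 - (V : Matrix (Fin 2) (Fin 2) ℂ))).re ≤ t}
      ≤ ∫ U, Real.exp (-(β * (Matrix.trace (1 - (U : Matrix (Fin 2) (Fin 2) ℂ))).re)) ∂(haarProbability (Matrix.specialUnitaryGroup (Fin 2) ℂ)) := by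
  set μ := haarProbability (Matrix.specialUnitaryGroup (Fin 2) ℂ) with hμ
  have hsm : Measurable fun U : Matrix.specialUnitaryGroup (Fin 2) ℂ => (Matrix.trace (1 - (U : Matrix (Fin 2) (Fin 2) ℂ))).re :=
    (Complex.continuous_re.comp ((continuous_const.sub continuous_subtype_val).matrix_trace)).measurable
  have hmeas : Measurable fun U : Matrix.specialUnitaryGroup (Fin 2) ℂ => Real.exp (-(β * (Matrix.trace (1 - (U : Matrix (Fin 2) (Fin 2) ℂ))).re)) :=
    Real.measurable_exp.comp ((hsm.const_mul β).neg)
  have hint : Integrable (fun U : Matrix.specialUnitaryGroup (Fin 2) ℂ => Real.exp (-(β * (Matrix.trace (1 - (U : Matrix (Fin 2) (Fin 2) ℂ))).re))) μ :=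
    Integrable.of_bound hmeas.aestronglyMeasurable 1 (ae_of_all _ fun U => by
      rw [Real.norm_eq_abs, abs_of_pos (Real.exp_pos _), Real.exp_le_one_iff]; nlinarith [(re_trace_one_sub_mem U).1])
  have hM := mul_meas_ge_le_integral_of_nonneg (ae_of_all _ fun U => (Real.exp_pos _).le) hint (Real.exp (-(β * t)))
  refine le_trans (mul_le_mul_of_nonneg_left (measureReal_mono (fun V hV => ?_)) (Real.exp_pos _).le) hM
  simp only [Set.mem_setOf_eq] at hV ⊢
  exact Real.exp_le_exp.2 (by nlinarith)

/-- **THE ONE-PLAQUETTE MASS OF `SU(2)` FROM BELOW, BY VALUE**: for `β ≥ 1∕4`,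
`e⁻¹∕8 · ((√β)⁻¹)³ ≤ ∫ e^{−β·Re tr(1 − V)} dHaar_{SU(2)}(V)` (window `t = 1∕β`; V39's `exists_le_plaquetteMass` for `N = 2` with the constant printed). [folklore] -/
theorem explicit_le_plaquetteMass_SU2 {β : ℝ} (hβ : 1 / 4 ≤ β) :
    (Real.exp 1)⁻¹ / 8 * ((Real.sqrt β)⁻¹) ^ 3
      ≤ ∫ U, Real.exp (-(β * (Matrix.trace (1 - (U : Matrix (Fin 2) (Fin 2) ℂ))).re)) ∂(haarProbability (Matrix.specialUnitaryGroup (Fin 2) ℂ)) := by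
  have hβ0 : 0 < β := by linarith
  have ht4 : β⁻¹ ≤ 4 := by rw [inv_le_iff_one_le_mul₀ hβ0]; linarith
  have hwin := sqrt_cube_div_eight_le_haarReal_traceWindow (inv_pos.2 hβ0) ht4
  have hcheb := exp_neg_mul_haarReal_le_plaquetteMass hβ0.le β⁻¹
  have he : Real.exp (-(β * β⁻¹)) = (Real.exp 1)⁻¹ := by rw [mul_inv_cancel₀ hβ0.ne', Real.exp_neg]
  rw [he] at hcheb
  rw [Real.sqrt_inv] at hwin
  have key := mul_le_mul_of_nonneg_left hwin (inv_pos.2 (Real.exp_pos 1)).le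
  have e : (Real.exp 1)⁻¹ / 8 * (Real.sqrt β)⁻¹ ^ 3 = (Real.exp 1)⁻¹ * ((Real.sqrt β)⁻¹ ^ 3 / 8) := by ring
  rw [e]
  exact key.trans hcheb

/-- **THE WEYL INTEGRAND UNDER A GAUSSIAN** (Jordan's inequality `1 − cos ψ ≥ 2ψ²∕π²` on `|ψ| ≤ π`, Mathlib's `Real.cos_le_one_sub_mul_cos_sq`, and `sin ψ ≤ ψ`):
for `β ≥ 0` and `0 ≤ ψ ≤ π`, `e^{−2β(1 − cos ψ)}·sin²ψ ≤ ψ²·e^{−(4β∕π²)·ψ²}`. [folklore] -/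
theorem weylIntegrand_le_gaussian {β ψ : ℝ} (hβ : 0 ≤ β) (h0 : 0 ≤ ψ) (hπ : ψ ≤ Real.pi) :
    Real.exp (-(2 * β * (1 - Real.cos ψ))) * Real.sin ψ ^ 2 ≤ ψ ^ 2 * Real.exp (-(4 * β / Real.pi ^ 2) * ψ ^ 2) := by
  have hπ0 := Real.pi_pos
  have hcos := Real.cos_le_one_sub_mul_cos_sq (show |ψ| ≤ Real.pi by rwa [abs_of_nonneg h0])
  have hsin0 : 0 ≤ Real.sin ψ := Real.sin_nonneg_of_nonneg_of_le_pi h0 hπ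
  have hsin : Real.sin ψ ≤ ψ := Real.sin_le h0
  have hj : 2 / Real.pi ^ 2 * ψ ^ 2 ≤ 1 - Real.cos ψ := by linarith
  have hj2 := mul_le_mul_of_nonneg_left hj (by positivity : (0 : ℝ) ≤ 2 * β)
  have e : 2 * β * (2 / Real.pi ^ 2 * ψ ^ 2) = 4 * β / Real.pi ^ 2 * ψ ^ 2 := by ring
  have h1 : Real.exp (-(2 * β * (1 - Real.cos ψ))) ≤ Real.exp (-(4 * β / Real.pi ^ 2) * ψ ^ 2) :=
    Real.exp_le_exp.2 (by rw [neg_mul]; linarith)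
  have h2 : Real.sin ψ ^ 2 ≤ ψ ^ 2 := pow_le_pow_left₀ hsin0 hsin 2
  rw [mul_comm (ψ ^ 2)]
  exact mul_le_mul h1 h2 (sq_nonneg _) (Real.exp_pos _).le

/-- **THE ONE-PLAQUETTE MASS OF `SU(2)` FROM ABOVE, BY VALUE**: for `β > 0`,
`∫ e^{−β·Re tr(1 − V)} dHaar_{SU(2)}(V) ≤ (π²√π∕16)·((√β)⁻¹)³` — Weyl's formula (V40e's `integral_exp_neg_traceDeficit_eq`), the Gaussian domination
`weylIntegrand_le_gaussian`, the half-line Gaussian moment `∫₀^∞ ψ² e^{−bψ²} dψ = b^{−3∕2}·Γ(3∕2)∕2` (Mathlib) and `Γ(3∕2) = √π∕2`; V39's `exists_plaquetteMass_le`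
for `N = 2` with the constant printed (`π²√π∕16 = 1.0933…`; truth `(2√π)⁻¹ = 0.2821…` asymptotically). [folklore] -/
theorem plaquetteMass_SU2_le_explicit {β : ℝ} (hβ : 0 < β) :
    ∫ U, Real.exp (-(β * (Matrix.trace (1 - (U : Matrix (Fin 2) (Fin 2) ℂ))).re)) ∂(haarProbability (Matrix.specialUnitaryGroup (Fin 2) ℂ))
      ≤ Real.pi ^ 2 * Real.sqrt Real.pi / 16 * ((Real.sqrt β)⁻¹) ^ 3 := by
  have hπ0 := Real.pi_pos
  rw [integral_exp_neg_traceDeficit_eq hβ.le]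
  have hb0 : 0 < 4 * β / Real.pi ^ 2 := by positivity
  -- the Gaussian majorant is integrable on `ℝ`
  have hint : Integrable (fun x : ℝ => x ^ 2 * Real.exp (-(4 * β / Real.pi ^ 2) * x ^ 2)) := by
    have h := integrable_rpow_mul_exp_neg_mul_sq hb0 (s := 2) (by norm_num)
    simpa only [Real.rpow_two] using h
  -- Step 1: domination on `(0, π)`
  have step1 : ∫ ψ in Set.Ioo 0 Real.pi, Real.exp (-(2 * β * (1 - Real.cos ψ))) * Real.sin ψ ^ 2
      ≤ ∫ ψ in Set.Ioo 0 Real.pi, ψ ^ 2 * Real.exp (-(4 * β / Real.pi ^ 2) * ψ ^ 2) :=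
    integral_mono_of_nonneg (ae_of_all _ fun ψ => mul_nonneg (Real.exp_pos _).le (sq_nonneg _)) hint.restrict
      (ae_restrict_of_forall_mem measurableSet_Ioo fun ψ hψ => weylIntegrand_le_gaussian hβ.le hψ.1.le hψ.2.le)
  -- Step 2: enlarge `(0, π)` to `(0, ∞)`
  have step2 : ∫ ψ in Set.Ioo 0 Real.pi, ψ ^ 2 * Real.exp (-(4 * β / Real.pi ^ 2) * ψ ^ 2)
      ≤ ∫ ψ in Set.Ioi 0, ψ ^ 2 * Real.exp (-(4 * β / Real.pi ^ 2) * ψ ^ 2) :=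
    setIntegral_mono_set hint.integrableOn (ae_of_all _ fun ψ => mul_nonneg (sq_nonneg _) (Real.exp_pos _).le)
      (ae_of_all _ fun ψ hψ => Set.Ioo_subset_Ioi_self hψ)
  -- Step 3: the half-line Gaussian moment
  have step3 := integral_rpow_mul_exp_neg_mul_rpow (p := 2) (q := 2) two_pos (by norm_num) hb0
  simp only [Real.rpow_two] at step3
  have hG : Real.Gamma ((2 + 1) / 2) = Real.sqrt Real.pi / 2 := by
    rw [show ((2 : ℝ) + 1) / 2 = 1 / 2 + 1 by norm_num, Real.Gamma_add_one (by norm_num), Real.Gamma_one_half_eq]; ring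
  have hbpow : (4 * β / Real.pi ^ 2) ^ (-(2 + 1) / 2 : ℝ) = (Real.sqrt (4 * β / Real.pi ^ 2))⁻¹ ^ 3 := by
    rw [show (-(2 + 1) / 2 : ℝ) = -((1 / 2) * 3) by norm_num, Real.rpow_neg hb0.le, inv_pow, Real.rpow_mul hb0.le, Real.sqrt_eq_rpow]
    norm_num
  have hsb : Real.sqrt (4 * β / Real.pi ^ 2) = 2 * Real.sqrt β / Real.pi := by
    rw [show 4 * β / Real.pi ^ 2 = (2 / Real.pi) ^ 2 * β by field_simp; ring, Real.sqrt_mul (sq_nonneg _), Real.sqrt_sq (by positivity)]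
    ring
  rw [hG, hbpow, hsb] at step3
  have hchain := (step1.trans step2).trans step3.le
  have hsβ : 0 < Real.sqrt β := Real.sqrt_pos.2 hβ
  have hfin := mul_le_mul_of_nonneg_left hchain (by positivity : (0 : ℝ) ≤ 2 / Real.pi)
  refine hfin.trans (le_of_eq ?_)
  field_simp
  ring

end Summit.QuantumFields.BalabanUV.T4Continuum.NE7b.CompactFibrePlaquetteMassSU2Explicit

end
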